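import Summits.FinalStateConjecture.FinalStateConjecture.Theorems.SwallowTheDatumUniversalWitnessFamilyRegionOneAssembly

/-!
# Crux `StarvedNecks.HonestFixedRadiusSettling` (stmt-FinalStateConjecture-13550), line `far-field-surgery`
# (reshape v6, sheet burial), stub `stub_regionOneFlatClauses`

The three honest clauses of the FLAT chart `Φ y = outMap M y = (y⁰ + 2 torH M ‖ỹ‖, ỹ)` (outgoing to ingoing
Kerr–Schild time) of the explicit `N = 1` decomposition of the Schwarzschild exterior `Kerr.region 0 (2M)`
(`…SwallowTheDatumUniversalWitnessFamilyRegionOneAssembly`), on `U = {x⁰ > T₀ + 1, ‖x̃‖ > ρ(x⁰)}`,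
`ρ = excision M = 4M + growth M`:

* (Hc.4) `dΦ(e₀) = e₀` is future-directed causal (`g(e₀, e₀) = −1 + 2M/r < 0`, `g(V, e₀) = −1`);
* (Hf.1) a flat point `Φ y` with `y⁰ < τ₂` lies in `J⁻` of the flat slab `Φ(U ∩ {y⁰ = τ₂})`: the
  HALF-SPEED OUTGOING curve `s ↦ Φ(y⁰ + s, (1 + s/2‖ỹ‖) ỹ)`, `s ∈ [0, τ₂ − y⁰]`, is future timelike —
  in the outgoing Eddington–Finkelstein form (`regionOneFlatChart_anchor`, `kerr_bilin_reflect`) its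
  velocity `(1, ỹ/2‖ỹ‖)` has `g = −1 + 1/4 + (2M/r)(−1 + 1/2)² = −3/4 + M/2r < −1/2` — and it ends on
  the slab because the excision radius is `1/2`-Lipschitz forward in time
  (`growth' = σ/(2 (1 + σ²)^{3/4}) ≤ 1/2`, mean value inequality);
* (Hf.2) for `τ' > T₀ + 1` the image of `{τ' ≤ y⁰, ρ(y⁰) + 1 ≤ ‖ỹ‖}` lies in the closed subset
  `{τ' ≤ p⁰ − 2 torH ‖p̃‖, ρ(p⁰ − 2 torH ‖p̃‖) + 1 ≤ ‖p̃‖}` of region I (`torH` is continuous off the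
  horizon), all of whose points are flat images of points with `y⁰ ≥ τ'` (`mem_image_flatChart`).

No definitions, no named facts; standard axioms.  References: Misner–Thorne–Wheeler 1973, §31.4
(Eddington–Finkelstein coordinates); O'Neill 1983, Ch. 5 (timecones), Ch. 14, pp. 402–403 (causality).
-/

set_option linter.dupNamespace false

noncomputable section

open scoped Manifold ContDiff Topology RealInnerProductSpace
open Set Filter Function Literature.Geometry.Lorentzian
open Summit.FinalStateConjecture.FinalStateConjecture.Theorems.SwallowTheDatum.UniversalWitnessFamily
  (torH staticTime excision exactRadius bend holeMap outMap vert ksTime)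

namespace Summit.FinalStateConjecture.FinalStateConjecture.Theorems.StarvedNecks.SheetBurial

section Proofs

open Summit.FinalStateConjecture.FinalStateConjecture.Theorems.SwallowTheDatum.UniversalWitnessFamily

/-! ## The excision radius is `1/2`-Lipschitz forward in time -/

/-- The derivative of the growth profile is at most `1/2`: with `σ = t/M`, `u = 1 + σ²`,
`growth' = σ/(2 √u · u^{1/4}) ≤ 1/2` because `σ ≤ √u` and `u^{1/4} ≥ 1`. -/
private theorem deriv_growth_le_half (M t : ℝ) :
    t / M / (2 * Real.sqrt (1 + (t / M) ^ 2) * Real.sqrt (Real.sqrt (1 + (t / M) ^ 2))) ≤ 1 / 2 := by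
  have hu1 : 1 ≤ 1 + (t / M) ^ 2 := by nlinarith [sq_nonneg (t / M)]
  have hsu : 1 ≤ Real.sqrt (1 + (t / M) ^ 2) := Real.one_le_sqrt.2 hu1
  have hssu : 1 ≤ Real.sqrt (Real.sqrt (1 + (t / M) ^ 2)) := Real.one_le_sqrt.2 hsu
  have hσ : t / M ≤ Real.sqrt (1 + (t / M) ^ 2) :=
    calc t / M ≤ |t / M| := le_abs_self _
      _ = Real.sqrt ((t / M) ^ 2) := (Real.sqrt_sq_eq_abs _).symm
      _ ≤ Real.sqrt (1 + (t / M) ^ 2) := Real.sqrt_le_sqrt (by linarith)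
  rw [div_le_iff₀ (by positivity)]
  calc t / M ≤ Real.sqrt (1 + (t / M) ^ 2) * 1 := by rw [mul_one]; exact hσ
    _ ≤ Real.sqrt (1 + (t / M) ^ 2) * Real.sqrt (Real.sqrt (1 + (t / M) ^ 2)) :=
        mul_le_mul_of_nonneg_left hssu (Real.sqrt_nonneg _)
    _ = 1 / 2 * (2 * Real.sqrt (1 + (t / M) ^ 2) * Real.sqrt (Real.sqrt (1 + (t / M) ^ 2))) := by ring

/-- **The growth profile (hence the excision radius `ρ = 4M + growth`) is `1/2`-Lipschitz forward in time**:
`growth M b − growth M a ≤ (b − a)/2` for `a ≤ b` (mean value inequality, `growth' ≤ 1/2`, `hasDerivAt_growth`). -/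
private theorem growth_sub_growth_le {M : ℝ} (hM : 0 < M) {a b : ℝ} (hab : a ≤ b) :
    growth M b - growth M a ≤ (b - a) / 2 := by
  have hdiff : Differentiable ℝ (growth M) := fun t ↦ (hasDerivAt_growth hM t).differentiableAt
  have hder : ∀ t, deriv (growth M) t ≤ 1 / 2 := fun t ↦ by
    rw [(hasDerivAt_growth hM t).deriv]; exact deriv_growth_le_half M t
  have := image_sub_le_mul_sub_of_deriv_le hdiff hder hab
  linarith

/-! ## The half-speed outgoing curve -/

section HalfOut

variable {M : ℝ} {y : E4} {q : ℝ → E4} {d : E4}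
  (hq : ∀ s, q s = E4.ofTimeSpace (y 0 + s) (max (1 + s / (2 * E4.spatialNorm y)) (1 / 2) • E4.spatial y))
  (hd : d = E4.ofTimeSpace 1 ((2 * E4.spatialNorm y)⁻¹ • E4.spatial y))

/-- The clamped dilation factor `max (1 + s/2r₀) (1/2)` equals `1 + s/2r₀` for `s ≥ −r₀`. -/
private theorem max_factor_eq {r₀ s : ℝ} (hr : 0 < r₀) (hs : -r₀ ≤ s) :
    max (1 + s / (2 * r₀)) (1 / 2) = 1 + s / (2 * r₀) := by
  apply max_eq_left
  have : -(1 / 2) ≤ s / (2 * r₀) := by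
    rw [le_div_iff₀ (by positivity)]; linarith
  linarith

include hq in
/-- Time coordinate of the pre-curve (outgoing Kerr–Schild time `y⁰ + s`). -/
private theorem halfOut_apply_zero (s : ℝ) : q s 0 = y 0 + s := by
  rw [hq]; exact E4.ofTimeSpace_apply_zero _ _

include hq in
/-- Spatial part of the pre-curve (the dilate of `ỹ`). -/
private theorem spatial_halfOut (s : ℝ) :
    E4.spatial (q s) = max (1 + s / (2 * E4.spatialNorm y)) (1 / 2) • E4.spatial y := by
  rw [hq]; exact E4.spatial_ofTimeSpace _ _

include hq in
/-- Spatial radius of the pre-curve. -/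
private theorem spatialNorm_halfOut (s : ℝ) :
    E4.spatialNorm (q s) = max (1 + s / (2 * E4.spatialNorm y)) (1 / 2) * E4.spatialNorm y := by
  have h : 0 < max (1 + s / (2 * ‖E4.spatial y‖)) (1 / 2) :=
    lt_of_lt_of_le (by norm_num) (le_max_right _ _)
  simp only [E4.spatialNorm, spatial_halfOut hq, norm_smul, Real.norm_eq_abs, abs_of_pos h]

include hq in
/-- The pre-curve stays at radius `≥ ‖ỹ‖/2`, hence off the horizon when `‖ỹ‖ > 4M`. -/
private theorem two_mul_lt_spatialNorm_halfOut (h4 : 4 * M < E4.spatialNorm y) (s : ℝ) :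
    2 * M < E4.spatialNorm (q s) := by
  rw [spatialNorm_halfOut hq]
  have h1 := mul_le_mul_of_nonneg_right (le_max_right (1 + s / (2 * E4.spatialNorm y)) (1 / 2))
    (E4.spatialNorm_nonneg y)
  linarith

include hq hd in
/-- Off the clamp (`s ≥ −‖ỹ‖`) the pre-curve is the affine line `s ↦ y + s d`, `d = (1, ỹ/2‖ỹ‖)`. -/
private theorem halfOut_eq_affine (hy : 0 < E4.spatialNorm y) {s : ℝ} (hs : -E4.spatialNorm y ≤ s) :
    q s = y + s • d := by
  apply E4.ext_of_apply_zero_of_spatial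
  · rw [halfOut_apply_zero hq, hd]
    simp
  · rw [spatial_halfOut hq, max_factor_eq hy hs, hd, map_add, map_smul, E4.spatial_ofTimeSpace, smul_smul,
      add_smul, one_smul, div_eq_mul_inv]

include hq hd in
/-- The pre-curve is differentiable with derivative `d` at every `s > −‖ỹ‖`. -/
private theorem hasDerivAt_halfOut (hy : 0 < E4.spatialNorm y) {s : ℝ} (hs : -E4.spatialNorm y < s) :
    HasDerivAt q d s := by
  have haff : HasDerivAt (fun u : ℝ ↦ y + u • d) d s := by
    simpa using ((hasDerivAt_id s).smul_const d).const_add y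
  refine haff.congr_of_eventuallyEq ?_
  filter_upwards [eventually_gt_nhds hs] with u hu
  exact halfOut_eq_affine hq hd hy hu.le

include hq hd in
/-- **The outgoing form on the velocity.** For `s ≥ 0`,
`g(outMap (q s))(D(outMap) d, D(outMap) d) = −3/4 + M/2r`, `r = ‖q̃ s‖`: by the Eddington–Finkelstein
identity this is the outgoing Kerr–Schild form on `d = (1, ỹ/2‖ỹ‖)` (`‖d̃‖² = 1/4`, `⟪q̃, d̃⟫/r = 1/2`). -/
private theorem kerr_bilin_halfOut (hM : 0 < M) (h4 : 4 * M < E4.spatialNorm y) {s : ℝ} (hs : 0 ≤ s) :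
    Kerr.bilin M 0 (outMap M (q s)) (fderiv ℝ (outMap M) (q s) d) (fderiv ℝ (outMap M) (q s) d) =
      -(3 / 4) + M / (2 * E4.spatialNorm (q s)) := by
  have hr₀ : 0 < E4.spatialNorm y := by linarith
  have hr₀' : E4.spatialNorm y ≠ 0 := hr₀.ne'
  have hx2 : 2 * M < E4.spatialNorm (q s) := two_mul_lt_spatialNorm_halfOut hq h4 s
  have hx0 : E4.spatialNorm (q s) ≠ 0 := by linarith
  have hφ := max_factor_eq hr₀ (show -E4.spatialNorm y ≤ s by linarith)
  have hφ0' : (1 + s / (2 * E4.spatialNorm y)) ≠ 0 := by positivity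
  have hd0 : d 0 = 1 := by rw [hd]; exact E4.ofTimeSpace_apply_zero _ _
  have hds : E4.spatial d = (2 * E4.spatialNorm y)⁻¹ • E4.spatial y := by
    rw [hd]; exact E4.spatial_ofTimeSpace _ _
  have hxs : E4.spatial (q s) = (1 + s / (2 * E4.spatialNorm y)) • E4.spatial y := by
    rw [spatial_halfOut hq, hφ]
  have hxr : E4.spatialNorm (q s) = (1 + s / (2 * E4.spatialNorm y)) * E4.spatialNorm y := by
    rw [spatialNorm_halfOut hq, hφ]
  have hyy : ⟪E4.spatial y, E4.spatial y⟫ = E4.spatialNorm y ^ 2 := real_inner_self_eq_norm_sq _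
  have h1 : ⟪E4.spatial d, E4.spatial d⟫ = 1 / 4 := by
    rw [hds, real_inner_smul_left, real_inner_smul_right, hyy]
    field_simp
    ring
  have h2 : ⟪E4.spatial (q s), E4.spatial d⟫ / E4.spatialNorm (q s) = 1 / 2 := by
    rw [hxs, hds, real_inner_smul_left, real_inner_smul_right, hyy, hxr]
    field_simp
  rw [regionOneFlatChart_anchor M hM (q s) hx2, kerr_bilin_reflect hx0, hd0, h1, h2]
  field_simp
  ring

include hq hd in
/-- The velocity has positive Kerr–Schild time component `1 + (4M/((r − 2M) r)) ⟪q̃, d̃⟫ ≥ 1`. -/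
private theorem fderiv_outMap_halfOut_apply_zero_pos (hM : 0 < M) (h4 : 4 * M < E4.spatialNorm y) (s : ℝ) :
    0 < fderiv ℝ (outMap M) (q s) d 0 := by
  have hx2 : 2 * M < E4.spatialNorm (q s) := two_mul_lt_spatialNorm_halfOut hq h4 s
  have h1 : ∀ (u : E4) (a : ℝ), (u + a • E4.basisVector 0) 0 = u 0 + a := fun u a ↦ by simp
  have hd0 : d 0 = 1 := by rw [hd]; exact E4.ofTimeSpace_apply_zero _ _
  have hds : E4.spatial d = (2 * E4.spatialNorm y)⁻¹ • E4.spatial y := by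
    rw [hd]; exact E4.spatial_ofTimeSpace _ _
  have hinner : 0 ≤ ⟪E4.spatial (q s), E4.spatial d⟫ := by
    rw [spatial_halfOut hq, hds, real_inner_smul_left, real_inner_smul_right, real_inner_self_eq_norm_sq]
    have hm : (0 : ℝ) ≤ max (1 + s / (2 * E4.spatialNorm y)) (1 / 2) := le_trans (by norm_num) (le_max_right _ _)
    exact mul_nonneg hm (mul_nonneg (inv_nonneg.2 (mul_nonneg zero_le_two (E4.spatialNorm_nonneg y))) (sq_nonneg _))
  have hβ : 0 ≤ 4 * M / ((E4.spatialNorm (q s) - 2 * M) * E4.spatialNorm (q s)) :=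
    div_nonneg (by linarith) (mul_nonneg (by linarith) (by linarith))
  rw [fderiv_outMap_apply hM hx2, h1, hd0]
  linarith [mul_nonneg hβ hinner]

variable (c : ℝ → Kerr.region 0 (Kerr.rPlus M 0)) (hc : ∀ s, (c s : E4) = outMap M (q s))

include hq hd hc in
/-- The half-speed outgoing curve `c = outMap ∘ q` (a curve in the open submanifold `Kerr.region 0 (2M)`) is
differentiable with velocity `D(outMap)(q s) d` at every `s > −‖ỹ‖`. -/
private theorem mdifferentiableAt_halfOut (hM : 0 < M) (h4 : 4 * M < E4.spatialNorm y) {s : ℝ}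
    (hs : -E4.spatialNorm y < s) :
    MDifferentiableAt 𝓘(ℝ, ℝ) 𝓘(ℝ, E4) c s ∧
      (velocity 𝓘(ℝ, E4) c s : E4) = fderiv ℝ (outMap M) (q s) d := by
  have hder : HasDerivAt (fun u ↦ outMap M (q u)) (fderiv ℝ (outMap M) (q s) d) s :=
    (differentiableAt_outMap hM (two_mul_lt_spatialNorm_halfOut hq h4 s)).hasFDerivAt.comp_hasDerivAt s
      (hasDerivAt_halfOut hq hd (by linarith) hs)
  have hval : (Subtype.val ∘ c) = fun u ↦ outMap M (q u) := funext hc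
  have hmd : MDifferentiableAt 𝓘(ℝ, ℝ) 𝓘(ℝ, E4) (Subtype.val ∘ c) s := by
    rw [hval]; exact hder.differentiableAt.mdifferentiableAt
  refine ⟨(mdifferentiableAt_subtypeVal_comp_curve_iff _).1 hmd, ?_⟩
  rw [← velocity_subtypeVal_comp (I := 𝓘(ℝ, E4)) (Kerr.region 0 (Kerr.rPlus M 0)) c s]
  change mfderiv 𝓘(ℝ, ℝ) 𝓘(ℝ, E4) (Subtype.val ∘ c) s (1 : ℝ) = _
  rw [hval, mfderiv_eq_fderiv, hder.hasFDerivAt.fderiv]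
  exact one_smul ℝ _

include hq hd hc in
/-- **The half-speed outgoing curve is future timelike** on `s ≥ 0`: `g(ċ, ċ) = −3/4 + M/2r < −1/2 < 0` and
`g(V, ċ) = −ċ⁰ < 0` for the time-orientation field `V = −g♯dt*` (`Kerr.bilin_timeVector`). -/
private theorem isFutureTimelikeCurveOn_halfOut [Kerr.Facts] (hM : 0 < M) (h4 : 4 * M < E4.spatialNorm y) :
    (Kerr.smoothMetric M 0 (Kerr.rPlus M 0)).IsFutureTimelikeCurveOn (ksTime hM.le) c (Ici 0) := by
  intro s hs
  have hs0 : (0 : ℝ) ≤ s := hs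
  have hlt : -E4.spatialNorm y < s := by linarith
  obtain ⟨hdiff, hv⟩ := mdifferentiableAt_halfOut hq hd c hc hM h4 hlt
  have hx2 : 2 * M < E4.spatialNorm (q s) := two_mul_lt_spatialNorm_halfOut hq h4 s
  have hrad : 0 < Kerr.radius 0 (outMap M (q s)) := by
    rw [Kerr.radius_zero_left, spatialNorm_outMap]; linarith
  have hpos := fderiv_outMap_halfOut_apply_zero_pos hq hd hM h4 s
  have htl : (Kerr.smoothMetric M 0 (Kerr.rPlus M 0)).val (c s) (velocity 𝓘(ℝ, E4) c s)
      (velocity 𝓘(ℝ, E4) c s) < 0 := by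
    rw [show (velocity 𝓘(ℝ, E4) c s) = (fderiv ℝ (outMap M) (q s) d : E4) from hv]
    show Kerr.bilin M 0 (c s).1 (fderiv ℝ (outMap M) (q s) d) (fderiv ℝ (outMap M) (q s) d) < 0
    rw [hc s, kerr_bilin_halfOut hq hd hM h4 hs0]
    have : M / (2 * E4.spatialNorm (q s)) < 1 / 4 := by
      rw [div_lt_iff₀ (by linarith)]; linarith
    linarith
  have hne : (fderiv ℝ (outMap M) (q s) d : E4) ≠ 0 := fun h ↦ by rw [h] at hpos; simp at hpos
  refine ⟨hdiff, htl, ⟨htl.le, ?_⟩, ?_⟩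
  · rw [show (velocity 𝓘(ℝ, E4) c s) = (fderiv ℝ (outMap M) (q s) d : E4) from hv]
    exact hne
  · rw [show (velocity 𝓘(ℝ, E4) c s) = (fderiv ℝ (outMap M) (q s) d : E4) from hv]
    show Kerr.bilin M 0 (c s).1 (Kerr.timeVector M 0 (c s).1) (fderiv ℝ (outMap M) (q s) d) < 0
    rw [hc s, Kerr.bilin_timeVector hrad]
    linarith

end HalfOut

/-! ## The three clauses -/

section Clauses

variable {M T₀ : ℝ} {U : TopologicalSpace.Opens E4}
  (hU : ∀ x, x ∈ U ↔ T₀ + 1 < x 0 ∧ excision M (x 0) < E4.spatialNorm x)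
  (Φ : (Minkowski.backgroundOn U).domain → Kerr.region 0 (Kerr.rPlus M 0))
  (hΦ : ∀ y, (Φ y : E4) = outMap M y)

include hU hΦ in
/-- **(Hc.4) `dΦ(e₀) = e₀` is future-directed causal in region I**: the `e₀`-derivative of the time shift
`2 torH ‖x̃‖` vanishes, `g(e₀, e₀) = −1 + 2M/r < 0` on `{r > 2M}` and `g(V, e₀) = −1 < 0`. -/
private theorem isFutureDirected_mfderiv_flatChart [Kerr.Facts] (hM : 0 < M)
    (y : (Minkowski.backgroundOn U).domain) :
    (ksTime hM.le).IsFutureDirected (mfderiv 𝓘(ℝ, E4) 𝓘(ℝ, E4) Φ y (E4.basisVector 0)) := by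
  have hyU := (hU y.1).1 y.2
  have hy2 : 2 * M < E4.spatialNorm y.1 := by linarith [four_mul_lt_excision hM (y.1 0), hyU.2]
  have hmf : mfderiv 𝓘(ℝ, E4) 𝓘(ℝ, E4) Φ y (E4.basisVector 0) = E4.basisVector 0 := by
    rw [mfderiv_apply_of_rep Φ (outMap M) hΦ y (differentiableAt_outMap hM hy2), fderiv_outMap_apply hM hy2,
      spatial_basisVector_zero, inner_zero_right, mul_zero, zero_smul, add_zero]
  rw [hmf]
  have hr : E4.spatialNorm (Φ y).1 = E4.spatialNorm y.1 := by rw [hΦ, spatialNorm_outMap]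
  have hr0 : E4.spatialNorm (Φ y).1 ≠ 0 := by rw [hr]; linarith
  have hrad : 0 < Kerr.radius 0 (Φ y).1 := radius_pos hM.le _
  have hne : (E4.basisVector 0 : E4) ≠ 0 := fun h ↦ by simpa using congrArg (fun v : E4 ↦ v 0) h
  refine ⟨⟨?_, hne⟩, ?_⟩
  · show Kerr.bilin M 0 (Φ y).1 (E4.basisVector 0) (E4.basisVector 0) ≤ 0
    rw [kerr_bilin_basisVector_zero_self hr0, hr]
    have : 2 * M / E4.spatialNorm y.1 < 1 := by rw [div_lt_one (by linarith)]; exact hy2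
    linarith
  · show Kerr.bilin M 0 (Φ y).1 (Kerr.timeVector M 0 (Φ y).1) (E4.basisVector 0) < 0
    rw [Kerr.bilin_timeVector hrad]
    simp

include hU hΦ in
/-- **(Hf.1) Flat-late points lie below later flat slabs.** A flat point `Φ y` with `y⁰ < τ₂` lies in the
causal past of `Φ(U ∩ {y⁰ = τ₂})`: the half-speed outgoing curve `s ↦ outMap (y⁰ + s, (1 + s/2‖ỹ‖) ỹ)` starts
at `Φ y`, is future timelike, and at `s = τ₂ − y⁰` reaches radius `‖ỹ‖ + s/2 > ρ(y⁰) + s/2 ≥ ρ(τ₂)` (the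
excision radius is `1/2`-Lipschitz), i.e. a point of the flat slab; reverse its parameter. -/
private theorem flatChart_mem_causalPast_timeSlab [Kerr.Facts] (hM : 0 < M) {τ₂ : ℝ}
    (y : (Minkowski.backgroundOn U).domain) (hyτ : y.1 0 < τ₂) :
    Φ y ∈ (Kerr.smoothMetric M 0 (Kerr.rPlus M 0)).causalPast (ksTime hM.le)
      (Φ '' (Minkowski.backgroundOn U).timeSlab τ₂) := by
  have hyU := (hU y.1).1 y.2
  have h4 : 4 * M < E4.spatialNorm y.1 := (four_mul_lt_excision hM _).trans hyU.2
  have hr₀ : 0 < E4.spatialNorm y.1 := by linarith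
  -- the pre-curve `q`, its direction `d` and the curve `c = outMap ∘ q` in region I
  obtain ⟨q, hq⟩ : ∃ q : ℝ → E4, ∀ s, q s =
      E4.ofTimeSpace (y.1 0 + s) (max (1 + s / (2 * E4.spatialNorm y.1)) (1 / 2) • E4.spatial y.1) :=
    ⟨_, fun _ ↦ rfl⟩
  obtain ⟨d, hd⟩ : ∃ d : E4, d = E4.ofTimeSpace 1 ((2 * E4.spatialNorm y.1)⁻¹ • E4.spatial y.1) :=
    ⟨_, rfl⟩
  obtain ⟨c, hc⟩ : ∃ c : ℝ → Kerr.region 0 (Kerr.rPlus M 0), ∀ s, (c s : E4) = outMap M (q s) :=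
    ⟨fun s ↦ ⟨outMap M (q s), outMap_mem_region hM (two_mul_lt_spatialNorm_halfOut hq h4 s)⟩, fun _ ↦ rfl⟩
  -- the curve starts at `Φ y`
  have hstart : c 0 = Φ y := by
    apply Subtype.ext
    rw [hc, hΦ, halfOut_eq_affine hq hd hr₀ (neg_nonpos.2 hr₀.le), zero_smul, add_zero]
  -- and ends on the flat slab `{y⁰ = τ₂}`
  have hz0 : q (τ₂ - y.1 0) 0 = τ₂ := by rw [halfOut_apply_zero hq]; ring
  have hzr : E4.spatialNorm (q (τ₂ - y.1 0)) = E4.spatialNorm y.1 + (τ₂ - y.1 0) / 2 := by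
    rw [spatialNorm_halfOut hq, max_factor_eq hr₀ (show -E4.spatialNorm y.1 ≤ τ₂ - y.1 0 by linarith)]
    field_simp
  have hzU : q (τ₂ - y.1 0) ∈ (Minkowski.backgroundOn U).domain := by
    show q (τ₂ - y.1 0) ∈ U
    rw [hU, hz0, hzr]
    refine ⟨by linarith, ?_⟩
    have h1 := growth_sub_growth_le hM (show y.1 0 ≤ τ₂ by linarith)
    linarith [hyU.2, excision_eq M (y.1 0), excision_eq M τ₂]
  have hend : c (τ₂ - y.1 0) ∈ Φ '' (Minkowski.backgroundOn U).timeSlab τ₂ :=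
    ⟨⟨q (τ₂ - y.1 0), hzU⟩, hz0, Subtype.ext (by rw [hΦ, hc])⟩
  -- the curve is future timelike on `[0, τ₂ − y⁰]`; reverse its parameter
  have hcurve : (Kerr.smoothMetric M 0 (Kerr.rPlus M 0)).IsFutureTimelikeCurveOn (ksTime hM.le) c
      (Icc 0 (τ₂ - y.1 0)) :=
    (isFutureTimelikeCurveOn_halfOut hq hd c hc hM h4).mono fun s hs ↦ hs.1
  rw [← hstart]
  refine LorentzianMetric.causalFuture_mono (singleton_subset_iff.2 hend) ?_
  refine Or.inr ⟨c (τ₂ - y.1 0), rfl, fun u ↦ c (0 + (τ₂ - y.1 0) - u), 0, τ₂ - y.1 0, by linarith, ?_,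
    by simp, by simp⟩
  exact hcurve.isFutureCausalCurveOn.reverseParam

include hU hΦ in
/-- **(Hf.2) Far flat slab portions are closed.** For `τ' > T₀ + 1` the image of
`{τ' ≤ y⁰, ρ(y⁰) + 1 ≤ ‖ỹ‖}` is contained in the closed subset
`{τ' ≤ p⁰ − 2 torH ‖p̃‖} ∩ {ρ(p⁰ − 2 torH ‖p̃‖) + 1 ≤ ‖p̃‖}` of region I (the outgoing time
`p⁰ − 2 torH ‖p̃‖` is continuous off the horizon), every point of which is the flat image of a point with
`y⁰ ≥ τ'`. -/
private theorem closure_image_flatChart_far_subset [Kerr.Facts] (hM : 0 < M) {τ' : ℝ} (hτ' : T₀ + 1 < τ') :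
    closure (Φ '' {y | τ' ≤ y.1 0 ∧ excision M (y.1 0) + 1 ≤ E4.spatialNorm y.1}) ⊆
      Φ '' {y | τ' ≤ y.1 0} := by
  -- the outgoing time `p⁰ − 2 torH ‖p̃‖` and the radius are continuous on the exterior
  have hc0 : Continuous fun p : E4 ↦ p 0 := PiLp.continuous_apply 2 _ 0
  have hsn : Continuous fun p : Kerr.region 0 (Kerr.rPlus M 0) ↦ E4.spatialNorm p.1 :=
    (continuous_norm.comp E4.spatial.continuous).comp continuous_subtype_val
  have htor : Continuous fun p : Kerr.region 0 (Kerr.rPlus M 0) ↦ torH M (E4.spatialNorm p.1) :=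
    (contDiffOn_torH hM (n := 0)).continuousOn.comp_continuous hsn fun p ↦ two_mul_lt_spatialNorm hM.le p
  have hf : Continuous fun p : Kerr.region 0 (Kerr.rPlus M 0) ↦ p.1 0 - 2 * torH M (E4.spatialNorm p.1) :=
    (hc0.comp continuous_subtype_val).sub (continuous_const.mul htor)
  have hC : IsClosed ({p : Kerr.region 0 (Kerr.rPlus M 0) | τ' ≤ p.1 0 - 2 * torH M (E4.spatialNorm p.1)} ∩
      {p | excision M (p.1 0 - 2 * torH M (E4.spatialNorm p.1)) + 1 ≤ E4.spatialNorm p.1}) :=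
    (isClosed_le continuous_const hf).inter
      (isClosed_le (((continuous_excision M).comp hf).add continuous_const) hsn)
  have h1 : ∀ (u : E4) (a : ℝ), (u + a • E4.basisVector 0) 0 = u 0 + a := fun u a ↦ by simp
  refine (closure_minimal ?_ hC).trans ?_
  · rintro _ ⟨y, hy, rfl⟩
    have h0 : (Φ y).1 0 - 2 * torH M (E4.spatialNorm (Φ y).1) = y.1 0 := by
      rw [hΦ, outMap_apply_zero, spatialNorm_outMap, add_sub_cancel_right]
    have hr : E4.spatialNorm (Φ y).1 = E4.spatialNorm y.1 := by rw [hΦ, spatialNorm_outMap]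
    refine ⟨?_, ?_⟩
    · show τ' ≤ (Φ y).1 0 - 2 * torH M (E4.spatialNorm (Φ y).1)
      rw [h0]; exact hy.1
    · show excision M ((Φ y).1 0 - 2 * torH M (E4.spatialNorm (Φ y).1)) + 1 ≤ E4.spatialNorm (Φ y).1
      rw [h0, hr]; exact hy.2
  · rintro p ⟨hp1, hp2⟩
    have hp1' : τ' ≤ p.1 0 - 2 * torH M (E4.spatialNorm p.1) := hp1
    have hp2' : excision M (p.1 0 - 2 * torH M (E4.spatialNorm p.1)) + 1 ≤ E4.spatialNorm p.1 := hp2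
    refine mem_image_flatChart hU Φ hΦ p (by linarith) (by linarith) fun z hz ↦ ?_
    show τ' ≤ z.1 0
    rw [hz, h1]
    linarith

end Clauses

end Proofs

/-- **Stub `stub_regionOneFlatClauses` of line `far-field-surgery` (Hc.4, Hf.1, Hf.2 for the outgoing
Kerr–Schild flat chart `outMap M` of region I).**  With `U = {x⁰ > T₀ + 1, ‖x̃‖ > excision M x⁰}` and
`Φ y = outMap M y = (y⁰ + 2 torH M ‖ỹ‖, ỹ)`: (Hc.4) `dΦ(e₀) = e₀` is future-directed causal on region I;
(Hf.1) a flat point with `T₀ + 1 < y⁰ < τ₂` lies in the causal past of the flat slab `{y⁰ = τ₂}` (follow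
the half-speed outgoing curve `s ↦ Φ(y⁰ + s, ỹ (1 + s/2‖ỹ‖))`, future timelike with `g = −3/4 + M/2r < 0`,
which stays ahead of the `1/2`-Lipschitz excised tube); (Hf.2) for `τ' > T₀ + 1` the closure in region I
of the image of the far slab portion `{τ' ≤ y⁰, excision M y⁰ + 1 ≤ ‖ỹ‖}` consists of flat points with
`y⁰ ≥ τ'`. [folklore] -/
theorem stub_regionOneFlatClauses :
    ∀ [Kerr.Facts] (M : ℝ) (hM : 0 < M) (T₀ : ℝ), 0 ≤ T₀ →
      ∀ (U : TopologicalSpace.Opens E4),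
      (∀ x, x ∈ U ↔ T₀ + 1 < x 0 ∧ excision M (x 0) < E4.spatialNorm x) →
      ∀ (Φ : (Minkowski.backgroundOn U).domain → Kerr.region 0 (Kerr.rPlus M 0)),
      (∀ y, (Φ y : E4) = outMap M y) →
      (∀ y : (Minkowski.backgroundOn U).domain, T₀ + 1 < y.1 0 →
        (ksTime hM.le).IsFutureDirected (mfderiv 𝓘(ℝ, E4) 𝓘(ℝ, E4) Φ y (E4.basisVector 0))) ∧
      (∀ τ₂ : ℝ, T₀ + 1 < τ₂ →
        Φ '' {y | T₀ + 1 < y.1 0 ∧ y.1 0 < τ₂} ⊆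
          (Kerr.smoothMetric M 0 (Kerr.rPlus M 0)).causalPast (ksTime hM.le)
            (Φ '' (Minkowski.backgroundOn U).timeSlab τ₂)) ∧
      (∀ τ' : ℝ, T₀ + 1 < τ' →
        closure (Φ '' {y | τ' ≤ y.1 0 ∧ excision M (y.1 0) + 1 ≤ E4.spatialNorm y.1}) ⊆
          Φ '' {y | τ' ≤ y.1 0}) := by
  intro _ M hM T₀ _ U hU Φ hΦ
  refine ⟨fun y _ ↦ isFutureDirected_mfderiv_flatChart hU Φ hΦ hM y, fun τ₂ _ ↦ ?_,
    fun τ' hτ' ↦ closure_image_flatChart_far_subset hU Φ hΦ hM hτ'⟩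
  rintro _ ⟨y, hy, rfl⟩
  exact flatChart_mem_causalPast_timeSlab hU Φ hΦ hM y hy.2

end Summit.FinalStateConjecture.FinalStateConjecture.Theorems.StarvedNecks.SheetBurial

end
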